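import Summits.HodgeConjecture.CorCM.RelativePairFlipPointwise
import Summits.HodgeConjecture.CorCM.GenericCMSubfieldTowerTypes
import Summits.HodgeConjecture.CorCM.PointwiseConjugationCompositum
import Literature.AlgebraicGeometry.Pohlmann1968.SeparatingCMFamilies
import HarnessLib

/-!
# A generic CM field INSIDE the CM field of the partner, III: the exact criterion under POINTWISE partial conjugations
# — a compositum test per off-fibre embedding instead of relative pair flips

COR-CM (cell `pub-hodgecm2`, binder seat `b16` gen 52, count-neutral claim TOWER-SHADOW, file F7 — CM fields and abelian
varieties; theorems only, no definition, no named fact, no `sorry`).  NEW as stated, hence under `Summits/`.  HONEST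
FRAMING: unconditional statements about pairs of CM types / CM abelian varieties; `HC_CM` is neither used nor asserted.

SETTING of F3 `GenericCMSubfieldTowerTypes` (`I = {i₀, i₁}`, `j : K₀ = K_{i₀} → K₁ = K_{i₁}`, multiplicities
`n(x) = #{y ∈ Φ₁ | y ∘ j = x}`), with the hypothesis (RPF) of F3 WEAKENED to:
* (PF₀) `K₀` has pair flips (generic CM field of its degree), and
* (PPC) for ONE embedding `x₀ : K₀ → ℂ` and every `y : K₁ → ℂ` with `y ∘ j ∉ {x₀, x̄₀}` there is SOME automorphism `σ_y`
  of `ℂ` with `σ_y ∘ x₀ = x̄₀` and `σ_y ∘ y = y` — by seat b16 gen 48 (`exists_conj_smul_iff_not_le`) equivalently the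
  COMPOSITUM TEST `y(K₁) ⊄ x₀(K₀) · y(K₁⁺)` for every off-fibre `y` (`pointwiseConj_offFibre_iff_forall_not_le`).
(RPF) asked for ONE `σ` serving all `y` at once (`pointwiseConj_offFibre_of_relPairFlip`: (RPF) ⟹ (PF₀) ∧ (PPC)); (PPC) fails
exactly when some foreign conjugate copy `y(K₁)`, enlarged by `x₀(K₀)`... contains no new imaginary element, e.g. when
`y(K₁) ⊇ x₀(K₀)` (the Galois closure of `K₀` inside `K₁`).  For `K₀` a non-Galois quartic and `K₁ = K₀(√β)` an octic
field `≠` the Galois closure of `K₀`, (PPC) holds — gen 40's `QuarticCMSubfieldOfOcticHodge` is recovered in this form.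

* §1 **`cmFamilyRank_add_card_eq_iff_of_pairFlip_of_pointwiseConj`** — (PF₀) + (PPC): `Hg(A₀ × A₁) = Hg(A₀) × Hg(A₁)`
  IFF `Φ₁` does NOT have constant unequal multiplicities over `Φ₀`; **`isNondegenerateFamily_iff_of_pairFlip_of_pointwiseConj`**;
  `cmFamilyRank_eq_cmTypeRank_of_pairFlip_of_multiplicities` (collapse in the exceptional case, (PF₀) only);
  **`isNondegenerateFamily_iff_of_pairFlip_of_pointwiseConj_of_quadratic`** (`[K₁:ℚ] = 2[K₀:ℚ]`: nondegenerate pair IFF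
  `Φ₁` nondegenerate, every pair of types); `pointwiseConj_offFibre_iff_forall_not_le`, `pointwiseConj_offFibre_of_relPairFlip`.
* §2 abelian varieties: **`hodgeConjectureFor_prod_of_pairFlip_of_pointwiseConj`** (HC with `B• = D•` on every
  `A₀^a × A₁^b` under the criterion, UNCONDITIONALLY), **`forall_prod_hodgeClassSpan_eq_iff_of_pairFlip_of_pointwiseConj`**
  (simple non-isogenous realisations: `B• = D•` on all products IFF the criterion), `…_of_quadratic`.

## References

* [Gordon1999HodgeAVSurvey] B. B. Gordon, *A survey of the Hodge conjecture for abelian varieties*, §3 Theorem (Imai,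
  Murty), 7.4–7.7 (Murty, Hazama), 9.4.3 (Yanai), 10.10.
* [Lang2002] S. Lang, *Algebra*, GTM 211, V §2 Thm. 2.8, VI §1 Thm. 1.12 (the compositum test).
* [Kubota1965] T. Kubota, *On the field extension by complex multiplication*, Trans. AMS 118 (1965), §2.
* [Dodson1984] B. Dodson, *The structure of Galois groups of CM-fields*, Trans. AMS 283 (1984), §1.1, §5.1.2.
-/

noncomputable section

open CategoryTheory CategoryTheory.Limits NumberField Module IntermediateField

namespace Summit.HodgeConjecture.CorCM

open Literature.NumberTheory.ComplexMultiplication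
open Literature.AlgebraicGeometry.Motives (AbelianVariety CMType)
open Literature.AlgebraicGeometry.HodgeTheory
open Literature.AlgebraicGeometry.ComplexMultiplication (IsCMTypeRealisation)
open Literature.AlgebraicGeometry.VanGeemen1994 (hodgeClassSpan)
open Literature.AlgebraicGeometry.Pohlmann1968
open Literature.Barriers.HodgeConjecture (divisorClassesSpan)
open scoped Classical

variable {I : Type} {K : I → Type} [∀ i, Field (K i)] [∀ i, NumberField (K i)] [∀ i, IsCMField (K i)] [Fintype I]
  [DecidableEq I] {Φ : ∀ i, CMType (K i)} {i₀ i₁ : I}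

omit [∀ i, IsCMField (K i)] [DecidableEq I] in
/-- `|⊔_i Hom(K_i, ℂ)| = Σ_i [K_i : ℚ]`. [folklore] -/
private theorem card_sigma_ringHom_eq_sum₅₂' : Fintype.card ((i : I) × (K i →+* ℂ)) = ∑ i, finrank ℚ (K i) := by
  rw [Fintype.card_sigma]
  exact Finset.sum_congr rfl fun i _ => Embeddings.card (K i) ℂ

/-! ### §1 CM types -/

section Types

omit [Fintype I] [DecidableEq I] in
/-- **(PPC) is a compositum test** (gen 48): off the fibres of `x₀`, a pointwise partial conjugation at `(x₀, y)` exists IFF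
`y(K₁) ⊄ x₀(K₀) · y(K₁⁺)`. [cite: Lang2002, V §2 Thm. 2.8 and VI §1 Thm. 1.12] -/
theorem pointwiseConj_offFibre_iff_forall_not_le (j : K i₀ →+* K i₁) (x₀ : K i₀ →+* ℂ) :
    (∀ y : K i₁ →+* ℂ, y.comp j ≠ x₀ → y.comp j ≠ (starRingAut : ℂ ≃+* ℂ) • x₀ →
        ∃ σ : ℂ ≃+* ℂ, σ • x₀ = (starRingAut : ℂ ≃+* ℂ) • x₀ ∧ σ • y = y) ↔
      ∀ y : K i₁ →+* ℂ, y.comp j ≠ x₀ → y.comp j ≠ (starRingAut : ℂ ≃+* ℂ) • x₀ →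
        ¬ y.toRatAlgHom.fieldRange ≤
          x₀.toRatAlgHom.fieldRange ⊔ (y.comp (maximalRealSubfield (K i₁)).subtype).toRatAlgHom.fieldRange :=
  forall_congr' fun y => forall_congr' fun _ => forall_congr' fun _ => exists_conj_smul_iff_not_le x₀ y

omit [∀ i, NumberField (K i)] [∀ i, IsCMField (K i)] [Fintype I] [DecidableEq I] in
/-- **(RPF) ⟹ (PPC)**: a relative pair flip at `x₀` serves as the pointwise partial conjugation for every off-fibre `y`
(so F3's criterion is a special case of this file's). [folklore] -/
theorem pointwiseConj_offFibre_of_relPairFlip (j : K i₀ →+* K i₁) {x₀ : K i₀ →+* ℂ}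
    (hflip : ∃ σ : ℂ ≃+* ℂ, σ • x₀ = (starRingAut : ℂ ≃+* ℂ) • x₀ ∧
      ∀ y : K i₁ →+* ℂ, y.comp j ≠ x₀ → y.comp j ≠ (starRingAut : ℂ ≃+* ℂ) • x₀ → σ • y = y) :
    ∀ y : K i₁ →+* ℂ, y.comp j ≠ x₀ → y.comp j ≠ (starRingAut : ℂ ≃+* ℂ) • x₀ →
      ∃ σ : ℂ ≃+* ℂ, σ • x₀ = (starRingAut : ℂ ≃+* ℂ) • x₀ ∧ σ • y = y :=
  Shadow.pointwise_of_relFlip (G := ℂ ≃+* ℂ) (fun y : K i₁ →+* ℂ => y.comp j) hflip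

/-- **THE EXACT CRITERION (rank form) under (PF₀) + (PPC).**  `I = {i₀, i₁}`, `j : K_{i₀} → K_{i₁}`, `K_{i₀}` with pair
flips, pointwise partial conjugations off the fibres of one `x₀`: `rank(Φ₀, Φ₁) + 2 = rank Φ₀ + rank Φ₁ + 1`
(`Hg(A₀ × A₁) = Hg(A₀) × Hg(A₁)`) IFF the multiplicities `n(x)` are NOT `a` on `Φ₀`, `b` off `Φ₀` with `a ≠ b`.
[cite: Gordon1999HodgeAVSurvey, §3 Theorem (1), 7.5–7.7 and 9.4.3] -/
theorem cmFamilyRank_add_card_eq_iff_of_pairFlip_of_pointwiseConj (hI : ∀ i, i = i₀ ∨ i = i₁) (h01 : i₀ ≠ i₁)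
    (j : K i₀ →+* K i₁)
    (hflip₀ : ∀ x : K i₀ →+* ℂ, ∃ σ : ℂ ≃+* ℂ, σ • x = (starRingAut : ℂ ≃+* ℂ) • x ∧
      ∀ x' : K i₀ →+* ℂ, x' ≠ x → x' ≠ (starRingAut : ℂ ≃+* ℂ) • x → σ • x' = x')
    {x₀ : K i₀ →+* ℂ}
    (hpc : ∀ y : K i₁ →+* ℂ, y.comp j ≠ x₀ → y.comp j ≠ (starRingAut : ℂ ≃+* ℂ) • x₀ →
      ∃ σ : ℂ ≃+* ℂ, σ • x₀ = (starRingAut : ℂ ≃+* ℂ) • x₀ ∧ σ • y = y) :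
    CMAlgebra.cmFamilyRank Φ + Fintype.card I = (∑ i, cmTypeRank (Φ i)) + 1 ↔
      ¬ ∃ a b : ℕ, a ≠ b ∧ ∀ x : K i₀ →+* ℂ,
        (Finset.univ.filter fun y : K i₁ →+* ℂ => y.comp j = x ∧ y ∈ (Φ i₁).1).card =
          if x ∈ (Φ i₀).1 then a else b := by
  haveI := isPretransitive_ringEquiv_complex (K := K i₀)
  haveI := isPretransitive_ringEquiv_complex (K := K i₁)
  haveI : Nonempty I := ⟨i₀⟩
  exact Shadow.typeRank_sigmaType_add_card_eq_iff_not_exists_multiplicities_of_pointwise (G := ℂ ≃+* ℂ)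
    (Φ := fun i => (Φ i).1) (fun i => isCMTypeWith_conj (Φ i)) hI h01
    (antiSpan_irreducible_of_pairFlip (isCMTypeWith_conj (Φ i₀)) hflip₀) (fun y : K i₁ →+* ℂ => y.comp j)
    (fun _ _ => rfl) hpc

/-- **THE EXACT CRITERION (nondegeneracy form) under (PF₀) + (PPC)**: the pair `(Φ₀, Φ₁)` is nondegenerate IFF `Φ₁` is
nondegenerate AND its multiplicities over `Hom(K_{i₀}, ℂ)` are not constant-unequal over `Φ₀` / off `Φ₀`.
[cite: Gordon1999HodgeAVSurvey, 7.5–7.7 and 9.4.3] [cite: Dodson1984, §5.1.2] -/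
theorem isNondegenerateFamily_iff_of_pairFlip_of_pointwiseConj (hI : ∀ i, i = i₀ ∨ i = i₁) (h01 : i₀ ≠ i₁)
    (j : K i₀ →+* K i₁)
    (hflip₀ : ∀ x : K i₀ →+* ℂ, ∃ σ : ℂ ≃+* ℂ, σ • x = (starRingAut : ℂ ≃+* ℂ) • x ∧
      ∀ x' : K i₀ →+* ℂ, x' ≠ x → x' ≠ (starRingAut : ℂ ≃+* ℂ) • x → σ • x' = x')
    {x₀ : K i₀ →+* ℂ}
    (hpc : ∀ y : K i₁ →+* ℂ, y.comp j ≠ x₀ → y.comp j ≠ (starRingAut : ℂ ≃+* ℂ) • x₀ →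
      ∃ σ : ℂ ≃+* ℂ, σ • x₀ = (starRingAut : ℂ ≃+* ℂ) • x₀ ∧ σ • y = y) :
    CMAlgebra.IsNondegenerateFamily Φ ↔ IsNondegenerate (Φ i₁) ∧
      ¬ ∃ a b : ℕ, a ≠ b ∧ ∀ x : K i₀ →+* ℂ,
        (Finset.univ.filter fun y : K i₁ →+* ℂ => y.comp j = x ∧ y ∈ (Φ i₁).1).card =
          if x ∈ (Φ i₀).1 then a else b := by
  haveI := isPretransitive_ringEquiv_complex (K := K i₀)
  haveI := isPretransitive_ringEquiv_complex (K := K i₁)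
  haveI : Nonempty I := ⟨i₀⟩
  have key := Shadow.typeRank_sigmaType_eq_iff_of_pairFlip_of_pointwise (G := ℂ ≃+* ℂ) (Φ := fun i => (Φ i).1)
    (fun i => isCMTypeWith_conj (Φ i)) hI h01 hflip₀ (fun y : K i₁ →+* ℂ => y.comp j) (fun _ _ => rfl) hpc
  rw [CMAlgebra.isNondegenerateFamily_iff, ← card_sigma_ringHom_eq_sum₅₂' (K := K), isNondegenerate_iff, cmTypeRank,
    ← Embeddings.card (K i₁) ℂ]
  exact key

/-- **COLLAPSE in the exceptional case, (PF₀) only**: if `K_{i₀}` has pair flips and `Φ₁` lies over `Φ₀` with constant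
unequal multiplicities then `rank(Φ₀, Φ₁) = rank Φ₁` exactly (`MT(A₀ × A₁) → MT(A₁)` is an isogeny).
[cite: Gordon1999HodgeAVSurvey, §3 Theorem (proof), 7.5 and 9.4.3] -/
theorem cmFamilyRank_eq_cmTypeRank_of_pairFlip_of_multiplicities (hI : ∀ i, i = i₀ ∨ i = i₁) (h01 : i₀ ≠ i₁)
    (j : K i₀ →+* K i₁)
    (hflip₀ : ∀ x : K i₀ →+* ℂ, ∃ σ : ℂ ≃+* ℂ, σ • x = (starRingAut : ℂ ≃+* ℂ) • x ∧
      ∀ x' : K i₀ →+* ℂ, x' ≠ x → x' ≠ (starRingAut : ℂ ≃+* ℂ) • x → σ • x' = x')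
    {a b : ℕ}
    (hmult : ∀ x : K i₀ →+* ℂ, (Finset.univ.filter fun y : K i₁ →+* ℂ => y.comp j = x ∧ y ∈ (Φ i₁).1).card =
      if x ∈ (Φ i₀).1 then a else b) (hab : a ≠ b) :
    CMAlgebra.cmFamilyRank Φ = cmTypeRank (Φ i₁) := by
  haveI := isPretransitive_ringEquiv_complex (K := K i₀)
  haveI : Nonempty I := ⟨i₀⟩
  rcases PairFlipTransport.typeRank_add_card_eq_or_typeRank_eq_of_irreducible (G := ℂ ≃+* ℂ)
      (Φ := fun i => (Φ i).1) (fun i => isCMTypeWith_conj (Φ i)) hI h01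
      (antiSpan_irreducible_of_pairFlip (isCMTypeWith_conj (Φ i₀)) hflip₀) with hadd | hcol
  · have hlt := cmFamilyRank_add_card_lt_of_multiplicities_self (Φ := Φ) h01 j hmult hab
    change CMAlgebra.cmFamilyRank Φ + Fintype.card I = (∑ i, cmTypeRank (Φ i)) + 1 at hadd
    omega
  · exact hcol

/-- **THE QUADRATIC CASE under (PF₀) + (PPC)**: `[K_{i₁} : ℚ] = 2 [K_{i₀} : ℚ]` ⟹ the pair is nondegenerate IFF `Φ₁` is —
for EVERY pair of types (constant unequal multiplicities `(2,0)`/`(0,2)` make `Φ₁` induced, hence degenerate).  For a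
non-Galois quartic `K_{i₀}` and an octic `K_{i₁} ≠` its Galois closure this is gen 40's theorem, now for every degree.
[cite: Gordon1999HodgeAVSurvey, 7.5–7.7 and 9.4.3] [cite: Kubota1965, §2 Lemma 2] -/
theorem isNondegenerateFamily_iff_of_pairFlip_of_pointwiseConj_of_quadratic (hI : ∀ i, i = i₀ ∨ i = i₁)
    (h01 : i₀ ≠ i₁) (j : K i₀ →+* K i₁) (hdeg : finrank ℚ (K i₁) = 2 * finrank ℚ (K i₀))
    (hflip₀ : ∀ x : K i₀ →+* ℂ, ∃ σ : ℂ ≃+* ℂ, σ • x = (starRingAut : ℂ ≃+* ℂ) • x ∧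
      ∀ x' : K i₀ →+* ℂ, x' ≠ x → x' ≠ (starRingAut : ℂ ≃+* ℂ) • x → σ • x' = x')
    {x₀ : K i₀ →+* ℂ}
    (hpc : ∀ y : K i₁ →+* ℂ, y.comp j ≠ x₀ → y.comp j ≠ (starRingAut : ℂ ≃+* ℂ) • x₀ →
      ∃ σ : ℂ ≃+* ℂ, σ • x₀ = (starRingAut : ℂ ≃+* ℂ) • x₀ ∧ σ • y = y) :
    CMAlgebra.IsNondegenerateFamily Φ ↔ IsNondegenerate (Φ i₁) := by
  rw [isNondegenerateFamily_iff_of_pairFlip_of_pointwiseConj hI h01 j hflip₀ hpc]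
  refine ⟨fun h => h.1, fun hnd => ⟨hnd, ?_⟩⟩
  rintro ⟨a, b, hab, hmult⟩
  exact not_isNondegenerate_of_multiplicities_of_quadratic j (Φ i₁) (Φ i₀) hdeg hmult hab hnd

end Types

/-! ### §2 Abelian varieties -/

section Varieties

variable [Nonempty I] {A : I → AbelianVariety ℂ} {ι : ∀ i, 𝓞 (K i) →+* End (A i)}
  {θ : ∀ i, K i →+* Module.End ℂ (complexBetti (A i).X 1)}

/-- **The Hodge conjecture on every `A₀^a × A₁^b`** (every `⨁_{j<N} A_{π j}`), with `B• = D•` there, under (PF₀) + (PPC)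
when `Φ₁` is nondegenerate and NOT of constant unequal multiplicities over `Φ₀` — UNCONDITIONALLY.
[cite: Gordon1999HodgeAVSurvey, 7.5 and 10.10] -/
theorem hodgeConjectureFor_prod_of_pairFlip_of_pointwiseConj (hI : ∀ i, i = i₀ ∨ i = i₁) (h01 : i₀ ≠ i₁)
    (j : K i₀ →+* K i₁)
    (hflip₀ : ∀ x : K i₀ →+* ℂ, ∃ σ : ℂ ≃+* ℂ, σ • x = (starRingAut : ℂ ≃+* ℂ) • x ∧
      ∀ x' : K i₀ →+* ℂ, x' ≠ x → x' ≠ (starRingAut : ℂ ≃+* ℂ) • x → σ • x' = x')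
    {x₀ : K i₀ →+* ℂ}
    (hpc : ∀ y : K i₁ →+* ℂ, y.comp j ≠ x₀ → y.comp j ≠ (starRingAut : ℂ ≃+* ℂ) • x₀ →
      ∃ σ : ℂ ≃+* ℂ, σ • x₀ = (starRingAut : ℂ ≃+* ℂ) • x₀ ∧ σ • y = y)
    (hnd : IsNondegenerate (Φ i₁))
    (hnot : ¬ ∃ a b : ℕ, a ≠ b ∧ ∀ x : K i₀ →+* ℂ,
      (Finset.univ.filter fun y : K i₁ →+* ℂ => y.comp j = x ∧ y ∈ (Φ i₁).1).card = if x ∈ (Φ i₀).1 then a else b)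
    (hA : ∀ i, IsCMTypeRealisation (Φ i) (A i) (ι i) (θ i)) {N : ℕ} (π : Fin N → I) :
    HodgeConjectureFor (⨁ fun j : Fin N => A (π j)).dim (⨁ fun j : Fin N => A (π j)).X ∧
      ∀ m : ℕ, hodgeClassSpan (⨁ fun j : Fin N => A (π j)).dim (⨁ fun j : Fin N => A (π j)).X m =
        divisorClassesSpan (⨁ fun j : Fin N => A (π j)).X (⨁ fun j : Fin N => A (π j)).dim m :=
  have h := (isNondegenerateFamily_iff_of_pairFlip_of_pointwiseConj hI h01 j hflip₀ hpc).2 ⟨hnd, hnot⟩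
  ⟨h.hodgeConjectureFor_prod hA π, fun m => h.hodgeClassSpan_prod_eq_divisorClassesSpan hA π m⟩

/-- **The quadratic case on abelian varieties under (PF₀) + (PPC)**: `[K_{i₁} : ℚ] = 2 [K_{i₀} : ℚ]`, `Φ₁` nondegenerate ⟹
the Hodge conjecture with `B• = D•` on every `A₀^a × A₁^b`, UNCONDITIONALLY. [cite: Gordon1999HodgeAVSurvey, 7.5 and 10.10]
[cite: Kubota1965, §2 Lemma 2] -/
theorem hodgeConjectureFor_prod_of_pairFlip_of_pointwiseConj_of_quadratic (hI : ∀ i, i = i₀ ∨ i = i₁) (h01 : i₀ ≠ i₁)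
    (j : K i₀ →+* K i₁) (hdeg : finrank ℚ (K i₁) = 2 * finrank ℚ (K i₀))
    (hflip₀ : ∀ x : K i₀ →+* ℂ, ∃ σ : ℂ ≃+* ℂ, σ • x = (starRingAut : ℂ ≃+* ℂ) • x ∧
      ∀ x' : K i₀ →+* ℂ, x' ≠ x → x' ≠ (starRingAut : ℂ ≃+* ℂ) • x → σ • x' = x')
    {x₀ : K i₀ →+* ℂ}
    (hpc : ∀ y : K i₁ →+* ℂ, y.comp j ≠ x₀ → y.comp j ≠ (starRingAut : ℂ ≃+* ℂ) • x₀ →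
      ∃ σ : ℂ ≃+* ℂ, σ • x₀ = (starRingAut : ℂ ≃+* ℂ) • x₀ ∧ σ • y = y)
    (hnd : IsNondegenerate (Φ i₁)) (hA : ∀ i, IsCMTypeRealisation (Φ i) (A i) (ι i) (θ i)) {N : ℕ}
    (π : Fin N → I) :
    HodgeConjectureFor (⨁ fun j : Fin N => A (π j)).dim (⨁ fun j : Fin N => A (π j)).X ∧
      ∀ m : ℕ, hodgeClassSpan (⨁ fun j : Fin N => A (π j)).dim (⨁ fun j : Fin N => A (π j)).X m =
        divisorClassesSpan (⨁ fun j : Fin N => A (π j)).X (⨁ fun j : Fin N => A (π j)).dim m :=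
  have h := (isNondegenerateFamily_iff_of_pairFlip_of_pointwiseConj_of_quadratic hI h01 j hdeg hflip₀ hpc).2 hnd
  ⟨h.hodgeConjectureFor_prod hA π, fun m => h.hodgeClassSpan_prod_eq_divisorClassesSpan hA π m⟩

/-- **SIMPLE, NON-ISOGENOUS realisations under (PF₀) + (PPC): `B• = D•` on ALL products `A₀^a × A₁^b` IFF the
criterion** (`Φ₁` nondegenerate and not of constant unequal multiplicities over `Φ₀`); otherwise some product carries an
exceptional Hodge class. [cite: Gordon1999HodgeAVSurvey, 7.5 and 7.6.1] -/
theorem forall_prod_hodgeClassSpan_eq_iff_of_pairFlip_of_pointwiseConj (hI : ∀ i, i = i₀ ∨ i = i₁) (h01 : i₀ ≠ i₁)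
    (j : K i₀ →+* K i₁)
    (hflip₀ : ∀ x : K i₀ →+* ℂ, ∃ σ : ℂ ≃+* ℂ, σ • x = (starRingAut : ℂ ≃+* ℂ) • x ∧
      ∀ x' : K i₀ →+* ℂ, x' ≠ x → x' ≠ (starRingAut : ℂ ≃+* ℂ) • x → σ • x' = x')
    {x₀ : K i₀ →+* ℂ}
    (hpc : ∀ y : K i₁ →+* ℂ, y.comp j ≠ x₀ → y.comp j ≠ (starRingAut : ℂ ≃+* ℂ) • x₀ →
      ∃ σ : ℂ ≃+* ℂ, σ • x₀ = (starRingAut : ℂ ≃+* ℂ) • x₀ ∧ σ • y = y)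
    (hA : ∀ i, IsCMTypeRealisation (Φ i) (A i) (ι i) (θ i)) (hs : ∀ i, (A i).IsSimple)
    (hniso : ∀ i i', i ≠ i' → ¬ AbelianVariety.IsIsogenous (A i) (A i')) :
    (∀ (N : ℕ) (π : Fin N → I) (m : ℕ),
      hodgeClassSpan (⨁ fun j : Fin N => A (π j)).dim (⨁ fun j : Fin N => A (π j)).X m =
        divisorClassesSpan (⨁ fun j : Fin N => A (π j)).X (⨁ fun j : Fin N => A (π j)).dim m) ↔
      IsNondegenerate (Φ i₁) ∧ ¬ ∃ a b : ℕ, a ≠ b ∧ ∀ x : K i₀ →+* ℂ,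
        (Finset.univ.filter fun y : K i₁ →+* ℂ => y.comp j = x ∧ y ∈ (Φ i₁).1).card =
          if x ∈ (Φ i₀).1 then a else b := by
  rw [← CMAlgebra.isNondegenerateFamily_iff_forall_prod_hodgeClassSpan_eq
    (CMAlgebra.isSeparatingFamily_of_isSimple_of_pairwise_not_isIsogenous hA hs hniso) hA]
  exact isNondegenerateFamily_iff_of_pairFlip_of_pointwiseConj hI h01 j hflip₀ hpc

end Varieties

end Summit.HodgeConjecture.CorCM

end
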